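import Literature.NumberTheory.DiophantineGeometry.AbcWave0GranvilleStarkTheorem1Lemma1Proofs
import Literature.NumberTheory.NumberFields.KummerDifferentBound
import HarnessLib

/-!
# Granville–Stark, Theorem 1 (abc.S22, `granville_stark`) from the Hilbert-class-field data alone:
# Lemma 1 split into its class-field-theoretic core and a PROVED Kummer step

Topic `Literature/NumberTheory/DiophantineGeometry`; proofs-only companion (theorems only, no
definitions, no named facts) of the named fact
`Literature.NumberTheory.DiophantineGeometry.granville_stark` (A. Granville, H. M. Stark, *ABC implies
no "Siegel zeros" for `L`-functions of characters with negative discriminant*, Invent. Math. 139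
(2000), Theorem 1).

After `granville_stark_of_discrBound` (`…Theorem1Lemma1Proofs.lean`) the only hypothesis left between
the tree and `granville_stark_holds` is Granville–Stark's **Lemma 1**: a number field containing
`∛j(τ_D)` and `√(j(τ_D) − 1728)` of root discriminant `≪ √d`.  Its printed proof is class field theory
throughout (`γ₂, γ₃` lie in the ray class field of `k = ℚ(√−d)` of conductor `6`, by Shimura
reciprocity; conductor–discriminant formula).  This file proves the Kummer-theoretic layer of that
statement and leaves as hypothesis only the classical facts about the field `H = k(j(τ_D))` itself:

* `exists_kummer_tower` (**proved**): for ANY number field `L` with a complex embedding `σ`, an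
  algebraic integer `j₀ ∈ 𝓞_L` with `(j₀) = 𝔞³` and `(j₀ − 1728) = 𝔟²` as ideals of `𝓞_L`, there is a
  number field `F ⊇ L` (namely `L(∛j₀, √(j₀ − 1728)) ⊂ ℂ`) with an embedding `σ₀` extending `σ`,
  elements `u, v` with `σ₀(u³) = σ(j₀)`, `v² = u³ − 1728`, and
  `|D_F| ≤ 6^{[F:ℚ]} · |D_L|^{[F:L]}` — two applications of the Kummer different bound
  `𝔇(L(ⁿ√a)/L) ∣ (n)` for `(a) = 𝔞ⁿ` (`Literature.NumberTheory.NumberFields.natAbs_discr_le_of_kummer`,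
  Bombieri–Gubler App. B Lemma B.2.6 in different form), `n = 3` then `n = 2`;
* `granville_stark_of_hilbert_cubeSquare`: **`granville_stark` follows from**: there are `B, d₁` such
  that for every imaginary quadratic `K` with `|d_K| ≥ d₁` some number field `L` with a complex
  embedding carries `j₀ ∈ 𝓞_L` over `j(τ_{d_K})` with `(j₀)` a cube, `(j₀ − 1728)` a square, and
  `|D_L| ≤ (B√|d_K|)^{[L:ℚ]}`.

For `L = H = K(j(τ_D))` these are: (a) `H/K` is unramified — `H` is the Hilbert class field, Cox,
*Primes of the form x² + ny²*, Thm. 11.1 / Cor. 11.37, giving `|D_H| = |d_K|^{[H:ℚ]/2}`, i.e. `B = 1`;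
(b) `(j(τ_D)) = 𝔞³`, `(j(τ_D) − 1728) = 𝔟²` in `𝓞_H` — the ideal-theoretic shadow of Weber's
`γ₂(τ) ∈ K(j(τ))` (`3 ∤ D`) and of `γ₃`, equivalently of the potential good reduction of CM elliptic
curves with inertia acting through `μ(𝓞_K) = {±1}` (`d > 4`); Cox Thm. 12.2, Silverman *Advanced
Topics* II §5.  Both are class field theory / complex multiplication and are NOT restated here as
named facts (D-0026); with them `granville_stark_holds` is `granville_stark_of_hilbert_cubeSquare`
applied to `B = 1`.  Compared with Lemma 1 as printed, the ray class field of conductor `6`, Shimura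
reciprocity and the conductor–discriminant formula are no longer needed: the factor `6` of Lemma 1 is
recovered here by Kummer theory (`2 · 3`).

## References

* A. Granville, H. M. Stark, Invent. Math. 139 (2000) 509–523: §2 (Lemma 1 and the remark after it,
  proof of Theorem 1). [GranvilleStark2000]
* E. Bombieri, W. Gubler, *Heights in Diophantine Geometry*, CUP 2006, App. B, Lemma B.2.6.
  [BombieriGubler2006]
* D. A. Cox, *Primes of the form x² + ny²*, 2nd ed. (2013), Thm. 11.1, Cor. 11.37, Thm. 12.2.
  [Cox2013]
-/

noncomputable section

open NumberField Module

namespace Literature.NumberTheory.DiophantineGeometry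

open Literature.NumberTheory.NumberFields Literature.NumberTheory.EllipticCurves
  Literature.NumberTheory.QuadraticFields.BinaryQuadraticForm

/-- **The Kummer tower over a cube-and-square radicand.**  Let `L` be a number field with a complex
embedding `σ`, and `j₀ ∈ 𝓞_L` with `(j₀) = 𝔞³`, `(j₀ − 1728) = 𝔟²`.  Then `F = L(∛j₀, √(j₀ − 1728)) ⊂ ℂ`
is a number field with `|D_F| ≤ 6^{[F:ℚ]} |D_L|^{[F:L]}`: by the Kummer different bound
(Bombieri–Gubler, Lemma B.2.6) `|D_{L(∛j₀)}| ≤ 3^{[L(∛j₀):ℚ]} |D_L|^{[L(∛j₀):L]}` and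
`|D_F| ≤ 2^{[F:ℚ]} |D_{L(∛j₀)}|^{[F:L(∛j₀)]}`, since `(j₀ − 1728)` stays a square in `L(∛j₀)`.
[cite: BombieriGubler2006, App. B Lemma B.2.6] [cite: GranvilleStark2000, §2 Lemma 1 (the factor 6)] -/
theorem exists_kummer_tower {L : Type} [Field L] [NumberField L] (σ : L →+* ℂ) (j₀ : 𝓞 L)
    (𝔞 𝔟 : Ideal (𝓞 L)) (h𝔞 : Ideal.span {j₀} = 𝔞 ^ 3) (h𝔟 : Ideal.span {j₀ - 1728} = 𝔟 ^ 2) :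
    ∃ (F : Type) (_ : Field F) (_ : NumberField F) (σ₀ : F →+* ℂ) (u v : F) (m : ℕ),
      σ₀ (u ^ 3) = σ j₀ ∧ v ^ 2 = u ^ 3 - 1728 ∧ finrank ℚ F = finrank ℚ L * m ∧
      (discr F).natAbs ≤ 6 ^ finrank ℚ F * (discr L).natAbs ^ m := by
  classical
  letI : Algebra L ℂ := σ.toAlgebra
  have hσ : ∀ x : L, algebraMap L ℂ x = σ x := fun x ↦ rfl
  -- first layer: `E = L(y₀)`, `y₀³ = σ(j₀)`
  obtain ⟨y₀, hy₀⟩ := IsAlgClosed.exists_pow_nat_eq (σ (j₀ : L)) (by norm_num : 0 < 3)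
  set E : IntermediateField L ℂ := IntermediateField.adjoin L {y₀} with hEdef
  have hy₀int : IsIntegral L y₀ := by
    refine IsIntegral.of_pow (by norm_num : 0 < 3) ?_
    rw [hy₀, ← hσ]
    exact isIntegral_algebraMap
  haveI hEfd : FiniteDimensional L E := IntermediateField.adjoin.finiteDimensional hy₀int
  haveI hENF : NumberField E :=
    { to_charZero := inferInstance, to_finiteDimensional := Module.Finite.trans L E }
  set yE : E := ⟨y₀, IntermediateField.mem_adjoin_simple_self L y₀⟩ with hyEdef
  have hyE3 : yE ^ 3 = algebraMap (𝓞 L) E j₀ := by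
    apply Subtype.ext
    rw [IsScalarTower.algebraMap_apply (𝓞 L) L E]
    show y₀ ^ 3 = algebraMap L ℂ (j₀ : L)
    rw [hσ, hy₀]
  have hgenE : IntermediateField.adjoin L {yE} = ⊤ := by
    apply IntermediateField.lift_injective
    rw [IntermediateField.lift_adjoin_simple, IntermediateField.lift_top]
  have hdE := natAbs_discr_le_of_kummer (H := L) (E := E) (by norm_num : 0 < 3) h𝔞 hyE3 hgenE
  -- second layer: `F = E(z₀)`, `z₀² = σ(j₀) − 1728`
  obtain ⟨z₀, hz₀⟩ := IsAlgClosed.exists_pow_nat_eq (σ (j₀ : L) - 1728) (by norm_num : 0 < 2)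
  set F : IntermediateField E ℂ := IntermediateField.adjoin E {z₀} with hFdef
  have hz₀int : IsIntegral E z₀ := by
    refine IsIntegral.of_pow (by norm_num : 0 < 2) ?_
    have : σ (j₀ : L) - 1728 = algebraMap E ℂ (algebraMap L E ((j₀ : L) - 1728)) := by
      rw [← IsScalarTower.algebraMap_apply, hσ, map_sub, map_ofNat]
    rw [hz₀, this]
    exact isIntegral_algebraMap
  haveI hFfd : FiniteDimensional E F := IntermediateField.adjoin.finiteDimensional hz₀int
  haveI hFNF : NumberField F :=
    { to_charZero := inferInstance, to_finiteDimensional := Module.Finite.trans E F }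
  set zF : F := ⟨z₀, IntermediateField.mem_adjoin_simple_self E z₀⟩ with hzFdef
  set a' : 𝓞 E := algebraMap (𝓞 L) (𝓞 E) (j₀ - 1728) with ha'
  have h𝔟' : Ideal.span {a'} = (𝔟.map (algebraMap (𝓞 L) (𝓞 E))) ^ 2 := by
    have := congr_arg (Ideal.map (algebraMap (𝓞 L) (𝓞 E))) h𝔟
    rwa [Ideal.map_span, Set.image_singleton, Ideal.map_pow] at this
  have hzF2 : zF ^ 2 = algebraMap (𝓞 E) F a' := by
    apply Subtype.ext
    show z₀ ^ 2 = algebraMap E ℂ (algebraMap (𝓞 E) E a')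
    rw [ha', ← IsScalarTower.algebraMap_apply (𝓞 L) (𝓞 E) E, IsScalarTower.algebraMap_apply (𝓞 L) L E,
      ← IsScalarTower.algebraMap_apply L E ℂ, hσ, hz₀, map_sub, map_sub, map_ofNat, map_ofNat]
  have hgenF : IntermediateField.adjoin E {zF} = ⊤ := by
    apply IntermediateField.lift_injective
    rw [IntermediateField.lift_adjoin_simple, IntermediateField.lift_top]
  have hdF := natAbs_discr_le_of_kummer (H := E) (E := F) (by norm_num : 0 < 2) h𝔟' hzF2 hgenF
  -- the embedding, the elements, the degrees
  haveI : Module.Free ℚ L := Module.Free.of_divisionRing ℚ L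
  haveI : Module.Free ℚ E := Module.Free.of_divisionRing ℚ E
  haveI : Module.Free L E := Module.Free.of_divisionRing L E
  haveI : Module.Free E F := Module.Free.of_divisionRing E F
  refine ⟨F, inferInstance, inferInstance, (algebraMap F ℂ : F →+* ℂ), algebraMap E F yE, zF,
    finrank L E * finrank E F, ?_, ?_, ?_, ?_⟩
  · rw [← map_pow, ← IsScalarTower.algebraMap_apply]
    show ((yE ^ 3 : E) : ℂ) = σ j₀
    rw [hyE3, IsScalarTower.algebraMap_apply (𝓞 L) L E]
    show algebraMap L ℂ (j₀ : L) = σ j₀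
    rfl
  · apply Subtype.ext
    show z₀ ^ 2 = ((algebraMap E F yE ^ 3 - 1728 : F) : ℂ)
    rw [← map_pow, hyE3, IsScalarTower.algebraMap_apply (𝓞 L) L E, hz₀]
    show σ (j₀ : L) - 1728 = algebraMap E ℂ (algebraMap L E (j₀ : L)) - 1728
    rw [← IsScalarTower.algebraMap_apply, hσ]
  · rw [← mul_assoc, Module.finrank_mul_finrank, Module.finrank_mul_finrank]
  · have hnE : finrank ℚ E = finrank ℚ L * finrank L E := (Module.finrank_mul_finrank ℚ L E).symm
    have hnF : finrank ℚ F = finrank ℚ E * finrank E F := (Module.finrank_mul_finrank ℚ E F).symm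
    calc (discr F).natAbs ≤ 2 ^ finrank ℚ F * (discr E).natAbs ^ finrank E F := hdF
      _ ≤ 2 ^ finrank ℚ F * (3 ^ finrank ℚ E * (discr L).natAbs ^ finrank L E) ^ finrank E F := by
        gcongr
      _ = 6 ^ finrank ℚ F * (discr L).natAbs ^ (finrank L E * finrank E F) := by
        rw [mul_pow, ← pow_mul, ← pow_mul, ← hnF, ← mul_assoc, ← mul_pow]
        norm_num

/-- **Granville–Stark, Theorem 1, from the Hilbert-class-field data** (Lemma 1 with its Kummer layer
proved): suppose there are `B, d₁` such that for every imaginary quadratic field `K` with `|d_K| ≥ d₁`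
there are a number field `L`, a complex embedding `σ`, `j₀ ∈ 𝓞_L` with `σ(j₀) = j(τ_{d_K})` (the
singular modulus of the principal class), ideals `𝔞, 𝔟` of `𝓞_L` with `(j₀) = 𝔞³`,
`(j₀ − 1728) = 𝔟²`, and `|D_L| ≤ (B√|d_K|)^{[L:ℚ]}` (for `L = K(j(τ_D))`, the Hilbert class field:
`B = 1`, Cox Thm. 11.1; and the cube/square structure of `(j)`, `(j − 1728)`, Cox Thm. 12.2).  Then
uniform `abc` implies `h(−d) ≥ (π/3 − δ)√d/log d` for `d ≥ d₀(δ)`, i.e. `granville_stark`: the Kummer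
tower `F = L(∛j₀, √(j₀ − 1728))` has `|D_F| ≤ (6B√|d_K|)^{[F:ℚ]}` (`exists_kummer_tower`), which is
the hypothesis of `granville_stark_of_discrBound` with constant `6B` (Granville–Stark's factor `6`).
[cite: GranvilleStark2000, §2 Lemma 1 and proof of Theorem 1] [cite: Cox2013, §11.A Thm. 11.1 and §12.A Thm. 12.2] -/
theorem granville_stark_of_hilbert_cubeSquare
    (H : ∃ B d₁ : ℝ, ∀ (K : Type) [Field K] [NumberField K],
      Module.finrank ℚ K = 2 → NumberField.InfinitePlace.nrRealPlaces K = 0 →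
      d₁ ≤ |(NumberField.discr K : ℝ)| →
        ∃ (L : Type) (_ : Field L) (_ : NumberField L) (σ : L →+* ℂ) (j₀ : 𝓞 L) (𝔞 𝔟 : Ideal (𝓞 L)),
          σ j₀ = formJ (principalForm (NumberField.discr K)) ∧
          Ideal.span {j₀} = 𝔞 ^ 3 ∧ Ideal.span {j₀ - 1728} = 𝔟 ^ 2 ∧
          |(NumberField.discr L : ℝ)| ≤ (B * √|(NumberField.discr K : ℝ)|) ^ Module.finrank ℚ L) :
    granville_stark := by
  obtain ⟨B, d₁, hH⟩ := H
  refine granville_stark_of_discrBound ⟨6 * B, d₁, fun K _ _ h2 h0 hd ↦ ?_⟩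
  obtain ⟨L, _, _, σ, j₀, 𝔞, 𝔟, hσj, h𝔞, h𝔟, hDL⟩ := hH K h2 h0 hd
  obtain ⟨F, _, _, σ₀, u, v, m, hu, hv, hm, hDF⟩ := exists_kummer_tower σ j₀ 𝔞 𝔟 h𝔞 h𝔟
  refine ⟨F, ‹_›, ‹_›, σ₀, u, v, by rw [hu, hσj], hv, ?_⟩
  -- `|D_F| ≤ 6^{n_F} |D_L|^m ≤ 6^{n_F} ((B√d)^{n_L})^m = (6B√d)^{n_F}`
  have hDL0 : (0 : ℝ) ≤ |(NumberField.discr L : ℝ)| := abs_nonneg _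
  have h1 : (|(NumberField.discr F : ℝ)|) = ((NumberField.discr F).natAbs : ℝ) := by
    rw [← Int.cast_abs, Int.abs_eq_natAbs, Int.cast_natCast]
  have h2 : (|(NumberField.discr L : ℝ)|) = ((NumberField.discr L).natAbs : ℝ) := by
    rw [← Int.cast_abs, Int.abs_eq_natAbs, Int.cast_natCast]
  have hDF' : ((NumberField.discr F).natAbs : ℝ) ≤ (6 : ℝ) ^ finrank ℚ F * ((NumberField.discr L).natAbs : ℝ) ^ m := by
    exact_mod_cast hDF
  rw [h1]
  rw [h2] at hDL
  calc ((NumberField.discr F).natAbs : ℝ) ≤ (6 : ℝ) ^ finrank ℚ F * ((NumberField.discr L).natAbs : ℝ) ^ m := hDF'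
    _ ≤ (6 : ℝ) ^ finrank ℚ F * ((B * √|(NumberField.discr K : ℝ)|) ^ finrank ℚ L) ^ m := by
      gcongr
    _ = (6 * B * √|(NumberField.discr K : ℝ)|) ^ finrank ℚ F := by
      rw [← pow_mul, ← hm]; ring

end Literature.NumberTheory.DiophantineGeometry

end
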